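import Summits.CriticalPhenomena.PercolationContinuityZ3.Theorems.PercNearOneGluingNoHeavyQuantSiblingMixture
import Summits.CriticalPhenomena.PercolationContinuityZ3.Theorems.PercNearOneGluingNoHeavyQuantForestBridge
import Summits.CriticalPhenomena.PercolationContinuityZ3.Theorems.PercNearOneGluingNoHeavyQuantAD3HeavyTop
import Summits.CriticalPhenomena.PercolationContinuityZ3.Theorems.PercNearOneGluingNoHeavyQuantDECAtTMixtures
import HarnessLib

/-!
# QUANT lane R8, T-DEC: THE SIBLING STEP FOR TOP-2 SIBLINGS, k-GENERAL — I. the near-sure core, the two chords of a law on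
# `{0,1,2}`, and the three branches of the induction step (arm-1 gen 56, architect)

builds on p205010 (kernel theorem, internal audit signed; external expert review pending)

Support file (`--supports stmt-CriticalPhenomena-4575`), QUANT lane seat prim-quant-arm-1 (gen 56, architect); memo
`run/shared/lean/prim/quant/prim-quant-arm-1-g56/ARCH-G56.md`.  Theorems only (file-local notation, no definitions); standard axioms,
no sorries.  Consumer: `…QuantTopTwoForest` — **every forest whose siblings' sub-forest laws live on `{0,1,2}` (every forest of 2-chains
`R[qᵢ](R[pᵢ])`, EVERY WIDTH, every root gate) is SDEC at every per-sibling-affordable floor `2x ≤ qᵢ·mean ρᵢ` (every tree-OK floor) —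
no oracle, no certificate.**

THE MECHANISM (arm-1 g55's extreme-point remark, ARCH-G55 §0 (6), made effective).  A law `t` on `{0,1,2}` of mean `m` is a same-mean
mixture of the two extreme laws of its mean: the gated double blob `D_m = gate_{m/2} δ₂` and the gated relay `B_m = gate_m δ₁` (`m ≤ 1`,
`topTwo_mix_lo_mul`) or the NEAR-SURE EXTREME `C_m = δ₁ ∗ gate_{m−1} δ₁ = {1: 2−m, 2: m−1}` (`m ≥ 1`, `topTwo_mix_hi_mul`); SDEC is convex
along same-mean mixtures of one sibling (`sdec_lconv_of_mixture`, g55).  The `D`/`B` extremes have gates `m/2 ≥ x`, `m ≥ 2x`: SLICES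
(`sdec_lconv_lconv_blob`: `sdec_slice_blob_of_mixLaw'` with the blob gate step `gatedSliceMixLaw'_holds`, then `sdec_mono_top`).  The `C`
extremes — the near-sure corner, inner gate `m − 1` possibly BELOW the floor, the only extreme outside the slice lemmas — form the
NEAR-SURE CORE `flaw CORE[rs]` = law of `|rs| + Σ_j Bern(r_j)`: every positive atom is `≥ |rs| ≥ (|rs| + Σ r_j)/2 ≥ T/2`, so the core has
NO positive low atom at any gate and is DEC at every layer by the moment criterion `decAt_all_of_noLow` (`sdec_core`; top-affordable since
`2x·|rs| ≤ |rs| + Σ r_j`).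

* `sdec_mono_top` — raising the declared top of an SDEC law (Theorem A above the old top);
* `ftop_core`, `flaw_core_cons`, `lawC_facts`, `core_sum_bounds`, `core_facts`, **`sdec_core`** (the near-sure core is SDEC at every
  `0 < x < 1` with `2x ≤ 1 + r_j`);
* `topTwo_mix_lo_mul`, `topTwo_mix_hi_mul` — the two chords (product forms);
* `sdec_lconv_lconv_blob` (blob branches), `lconv_lconv_right_comm` (core branch bookkeeping), **`sdec_topTwo_assemble`** (the step).

HONEST STATUS.  Tools; `SiblingStep` / `GateStepN` / `LightResidDECOracle` / `FarTreeRow` OPEN for siblings of top `≥ 3`; RATE class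
(log\*) / honest sentence of `run/shared/lean/prim/quant/README.md` unchanged.  [this work].  Extreme points of moment sets: classical; nothing
here is cited as a published result.  The gluing rows served [cite: KozmaNitzan2024, Conjecture 3 (p. 15)]; product measure
[cite: Grimmett1999, §1.3 p. 10].
-/

noncomputable section

open scoped BigOperators

namespace Summit.CriticalPhenomena.PercolationContinuityZ3.Theorems
namespace Quant
namespace LawDec

open Finset

/-- the point mass `δ_K` -/
local notation3 "δ[" K "]" => (fun k : ℕ => if k = (K : ℕ) then (1 : ℝ) else 0)

/-- the 2-chain sub-forest law `ρ_p = δ₁ ∗ gate_p δ₁ = {1: 1−p, 2: p}` -/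
local notation3 "ρ₂[" p "]" => lconv 1 1 (fun k : ℕ => if k = (1 : ℕ) then (1 : ℝ) else 0)
  (gate (fun k : ℕ => if k = (1 : ℕ) then (1 : ℝ) else 0) p)

/-- the near-sure extreme as a pseudo-sibling with the sure root gate `1` (data only; `flaw` does not need `q < 1`) -/
local notation3 "CS[" r "]" => (⟨1, 0, 0, 2, ρ₂[r]⟩ : Sib)

/-- **the near-sure core** of inner gates `rs`: the pseudo-sibling list whose forest law `flaw CORE[rs]` is the law of `|rs| + Σ_j Bern(r_j)` -/
local notation3 "CORE[" rs "]" => List.map (fun r : ℝ => CS[r]) rs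

/-! ### Raising the declared top -/

/-- **raising the declared top of an SDEC law**: a probability law on `{0..M}`, SDEC at `0 < x < 1`, is SDEC at `x` on `{0..M′}` for every
`M′ ≥ M` with `x·M′ ≤ mean` (below `M` the same decompositions; at and above `M` Theorem A, `decAt_of_top_le`). [this work] -/
theorem sdec_mono_top {x : ℝ} {M M' : ℕ} {μ : ℕ → ℝ} (hx0 : 0 < x) (hx1 : x < 1) (hμ0 : ∀ h, 0 ≤ μ h)
    (hμM : ∀ h, M < h → μ h = 0) (hμ1 : ∑ h ∈ Finset.range (M + 1), μ h = 1) (hMM : M ≤ M')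
    (hta : x * (M' : ℝ) ≤ ∑ h ∈ Finset.range (M + 1), (h : ℝ) * μ h) (hS : SDEC x M μ) : SDEC x M' μ := by
  intro a ha0 ha1 j hj
  obtain ⟨g0, gM, g1⟩ := gate_laws M μ a ha0.le ha1 hμ0 hμM hμ1
  have hax1 : a * x < 1 := by nlinarith
  rw [decAt_iff_decAtT, sum_range_widen M M' hMM _ gM]
  by_cases hjM : j < M
  · have d := hS a ha0 ha1 j hjM
    rw [decAt_iff_decAtT] at d
    exact decAtT_mono_top d hMM
  · have htop : ∀ h, 0 < gate μ a h → a * x * (h : ℝ) ≤ ∑ k ∈ Finset.range (M + 1), (k : ℝ) * gate μ a k := by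
      intro h hh
      have hhM : h ≤ M := by
        by_contra hlt
        exact (lt_irrefl (0 : ℝ)) (by rw [gM h (not_le.1 hlt)] at hh; exact hh)
      rw [sum_mul_gate]
      have h1 : (h : ℝ) ≤ M' := by exact_mod_cast hhM.trans hMM
      have h2 : a * x * (h : ℝ) ≤ a * x * (M' : ℝ) := mul_le_mul_of_nonneg_left h1 (mul_pos ha0 hx0).le
      have h3 : a * (x * (M' : ℝ)) ≤ a * ∑ k ∈ Finset.range (M + 1), (k : ℝ) * μ k := mul_le_mul_of_nonneg_left hta ha0.le
      linarith
    have d := decAt_of_top_le M (gate μ a) g0 gM g1 (a * x) hax1 htop j (not_lt.1 hjM)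
    rw [decAt_iff_decAtT] at d
    exact decAtT_mono_top d hMM

/-! ### The near-sure core -/

/-- the near-sure core has top `2|rs|`. [this work] -/
theorem ftop_core : ∀ rs : List ℝ, ftop CORE[rs] = 2 * rs.length
  | [] => rfl
  | r :: rs => by simp only [List.map_cons, ftop, List.length_cons, ftop_core rs]; ring

/-- the near-sure core law unfolds as the convolution of the near-sure extremes `ρ₂[r_j] = {1: 1−r_j, 2: r_j}` (law of `|rs| + Σ_j Bern(r_j)`).
[this work] -/
theorem flaw_core_cons (r : ℝ) (rs : List ℝ) :
    flaw CORE[r :: rs] = lconv (ftop CORE[rs]) 2 (flaw CORE[rs]) (ρ₂[r]) := by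
  simp only [List.map_cons, flaw, gate_one]

/-- the near-sure extreme: nonnegative for `0 ≤ r ≤ 1`, vanishing above `2`, mass `1`, mean `1 + r`, no atom at `0`. [this work] -/
theorem lawC_facts (r : ℝ) (hr0 : 0 ≤ r) (hr1 : r ≤ 1) :
    (∀ h, 0 ≤ (ρ₂[r]) h) ∧ (∀ h, 2 < h → (ρ₂[r]) h = 0) ∧ (∑ h ∈ Finset.range (2 + 1), (ρ₂[r]) h = 1) ∧
      (∑ h ∈ Finset.range (2 + 1), (h : ℝ) * (ρ₂[r]) h = 1 + r) ∧ (ρ₂[r]) 0 = 0 := by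
  refine ⟨fun h => ?_, fun h hh => ?_, ?_, ?_, ?_⟩
  · rw [tc_rho_apply]; split_ifs <;> linarith
  · rw [tc_rho_apply, if_neg (by omega), if_neg (by omega), add_zero]
  · simp [Finset.sum_range_succ, tc_rho_apply]
  · simp [Finset.sum_range_succ, tc_rho_apply]; ring
  · simp [tc_rho_apply]

/-- `2x·|rs| ≤ |rs| + Σ rs` when `2x ≤ 1 + r_j` for every `j`, and `Σ rs ≤ |rs|` when every `r_j ≤ 1`. [this work] -/
theorem core_sum_bounds (x : ℝ) : ∀ rs : List ℝ, (∀ r ∈ rs, r ≤ 1) → (∀ r ∈ rs, 2 * x ≤ 1 + r) →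
    2 * x * (rs.length : ℝ) ≤ rs.length + rs.sum ∧ rs.sum ≤ rs.length
  | [], _, _ => by simp
  | r :: rs, h1, hx => by
    obtain ⟨ih1, ih2⟩ := core_sum_bounds x rs (fun r' hr' => h1 r' (List.mem_cons_of_mem r hr'))
      (fun r' hr' => hx r' (List.mem_cons_of_mem r hr'))
    have hr := h1 r List.mem_cons_self
    have hxr := hx r List.mem_cons_self
    simp only [List.length_cons, List.sum_cons, Nat.cast_succ]
    constructor <;> linarith

/-- **law facts of the near-sure core**: nonnegative, vanishing above its top `2|rs|`, mass `1`, mean `|rs| + Σ rs`, and NO atom below `|rs|`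
(every configuration reaches the `|rs|` sure relays). [this work] -/
theorem core_facts : ∀ rs : List ℝ, (∀ r ∈ rs, 0 ≤ r ∧ r ≤ 1) →
    (∀ h, 0 ≤ flaw CORE[rs] h) ∧ (∀ h, ftop CORE[rs] < h → flaw CORE[rs] h = 0) ∧
    (∑ h ∈ Finset.range (ftop CORE[rs] + 1), flaw CORE[rs] h = 1) ∧
    (∑ h ∈ Finset.range (ftop CORE[rs] + 1), (h : ℝ) * flaw CORE[rs] h = rs.length + rs.sum) ∧
    (∀ h, h < rs.length → flaw CORE[rs] h = 0)
  | [], _ => by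
    refine ⟨fun h => ?_, fun h hh => ?_, by simp [flaw, ftop], by simp [flaw, ftop], fun h hh => by simp at hh⟩
    · simp only [List.map_nil, flaw]; split_ifs <;> norm_num
    · simp only [List.map_nil, flaw, ftop] at hh ⊢; rw [if_neg (by omega)]
  | r :: rs, hrs => by
    obtain ⟨c0, cM, c1, cmn, clow⟩ := core_facts rs (fun r' hr' => hrs r' (List.mem_cons_of_mem r hr'))
    obtain ⟨hr0, hr1⟩ := hrs r List.mem_cons_self
    obtain ⟨l0, lM, l1, lmn, lz⟩ := lawC_facts r hr0 hr1
    have e : ftop CORE[r :: rs] = ftop CORE[rs] + 2 := by simp only [List.map_cons, ftop]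
    rw [e, flaw_core_cons]
    simp only [List.length_cons, List.sum_cons, Nat.cast_succ]
    refine ⟨fun h => lconv_nonneg _ _ _ _ c0 l0 h, fun h hh => lconv_eq_zero _ _ _ _ h hh,
      sum_lconv _ _ _ _ c1 l1, ?_, fun h hh => ?_⟩
    · rw [sum_mul_lconv _ _ _ _ c1 l1, cmn, lmn]; ring
    · -- no atom below `|rs| + 1`: a charged term `flaw CORE[rs] i · ρ₂[r] k` has `i ≥ |rs|` and `k ≥ 1`
      change (∑ i ∈ Finset.range (ftop CORE[rs] + 1), ∑ k ∈ Finset.range (2 + 1),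
        if i + k = h then flaw CORE[rs] i * (ρ₂[r]) k else 0) = 0
      refine Finset.sum_eq_zero fun i _ => Finset.sum_eq_zero fun k _ => ?_
      split_ifs with hik
      · by_cases hk : k = 0
        · subst hk; rw [lz, mul_zero]
        · rw [clow i (by omega), zero_mul]
      · rfl

/-- **THE NEAR-SURE CORE IS SDEC** at every floor `0 < x < 1` with `2x ≤ 1 + r_j` for all `j` (`0 ≤ r_j ≤ 1`): at gate `a` its positive atoms are
`≥ |rs| ≥ (|rs| + Σ r_j)/2 ≥ T/2` — no positive low atom —, and it is top-affordable (`2x|rs| ≤ |rs| + Σ r_j`), so the moment criterion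
`decAt_all_of_noLow` applies at every layer.  This is the near-sure corner of the sibling step, inner gates below the floor included. [this work] -/
theorem sdec_core {x : ℝ} (hx0 : 0 < x) (hx1 : x < 1) (rs : List ℝ) (hrs : ∀ r ∈ rs, 0 ≤ r ∧ r ≤ 1)
    (hx : ∀ r ∈ rs, 2 * x ≤ 1 + r) : SDEC x (ftop CORE[rs]) (flaw CORE[rs]) := by
  intro a ha0 ha1 j hj
  obtain ⟨c0, cM, c1, cmn, clow⟩ := core_facts rs hrs
  obtain ⟨hsx, hs1⟩ := core_sum_bounds x rs (fun r hr => (hrs r hr).2) hx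
  obtain ⟨g0, gM, g1⟩ := gate_laws (ftop CORE[rs]) (flaw CORE[rs]) a ha0.le ha1 c0 cM c1
  have gmn : ∑ h ∈ Finset.range (ftop CORE[rs] + 1), (h : ℝ) * gate (flaw CORE[rs]) a h = a * (rs.length + rs.sum) := by
    rw [sum_mul_gate, cmn]
  have hax0 : 0 < a * x := mul_pos ha0 hx0
  have hax1 : a * x < 1 := by nlinarith
  have htop : ((ftop CORE[rs] : ℕ) : ℝ) = 2 * rs.length := by rw [ftop_core]; push_cast; ring
  refine decAt_all_of_noLow (a * x) (ftop CORE[rs]) (gate (flaw CORE[rs]) a) hax0 hax1 g0 gM g1 ?_ ?_ j hj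
  · rw [gmn, htop]; nlinarith
  · intro h h1 hpos
    rw [gmn]
    have hch : flaw CORE[rs] h ≠ 0 := by
      intro hz; rw [gate_apply, hz, if_neg (by omega)] at hpos; simp at hpos
    have hnh : rs.length ≤ h := by
      by_contra hlt; exact hch (clow h (not_le.1 hlt))
    have hnh' : (rs.length : ℝ) ≤ h := by exact_mod_cast hnh
    have hsum0 : 0 ≤ (rs.length : ℝ) + rs.sum := by
      have := c0 0; nlinarith [Nat.cast_nonneg (α := ℝ) rs.length, hsx, hx0]
    nlinarith

/-! ### The two chords of a law on `{0,1,2}` -/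

/-- **THE LOWER CHORD (product form)**: for a law `t` on `{0,1,2}` (mass `1`) of mean `m = t 1 + 2·t 2`:
`m·t = 2t₂·gate_{m/2} δ₂ + t₁·gate_m δ₁` (used for `m ≤ 1`). [this work] -/
theorem topTwo_mix_lo_mul (t : ℕ → ℝ) (m : ℝ) (htM : ∀ h, 2 < h → t h = 0) (ht1 : t 0 + t 1 + t 2 = 1)
    (hm : t 1 + 2 * t 2 = m) (h : ℕ) :
    m * t h = 2 * t 2 * gate δ[2] (m / 2) h + t 1 * gate δ[1] m h := by
  subst hm
  rw [gate_apply, gate_apply]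
  by_cases h0 : h = 0
  · subst h0
    have e : t 0 = 1 - t 1 - t 2 := by linarith
    simp; rw [e]; ring
  by_cases h1 : h = 1
  · subst h1; simp; ring
  by_cases h2 : h = 2
  · subst h2; simp; ring
  rw [htM h (by omega)]; simp [h0, h1, h2]

/-- **THE UPPER CHORD (product form)**: for a law `t` on `{0,1,2}` (mass `1`) of mean `m = t 1 + 2·t 2`:
`(2 − m)·t = 2t₀·gate_{m/2} δ₂ + t₁·{1: 2−m, 2: m−1}` (used for `m ≥ 1`). [this work] -/
theorem topTwo_mix_hi_mul (t : ℕ → ℝ) (m : ℝ) (htM : ∀ h, 2 < h → t h = 0) (ht1 : t 0 + t 1 + t 2 = 1)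
    (hm : t 1 + 2 * t 2 = m) (h : ℕ) :
    (2 - m) * t h = 2 * t 0 * gate δ[2] (m / 2) h + t 1 * (ρ₂[m - 1]) h := by
  subst hm
  rw [gate_apply, lawC_apply]
  by_cases h0 : h = 0
  · subst h0; simp; ring
  by_cases h1 : h = 1
  · subst h1; simp; ring
  by_cases h2 : h = 2
  · subst h2
    have e : t 0 = 1 - t 1 - t 2 := by linarith
    simp; rw [e]; ring
  rw [htM h (by omega)]; simp [h0, h1, h2]

/-! ### The three branches of the induction step, generically -/

/-- **the blob branches**: for laws `α` on `{0..N}`, `β` on `{0..B}` with `α ∗ β` a probability law, top-affordable and SDEC at `x`, and a blob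
`gate δ_K g` of size `K ∈ {1,2}` declared on `{0..2}` with `x ≤ g ≤ 1`, `2x ≤ g·K`: `α ∗ (β ∗ gate_g δ_K)` is SDEC at `x` on `{0..N+B+2}` (a slice
of `α ∗ β` — `sdec_slice_blob_of_mixLaw'` with `gatedSliceMixLaw'_holds` —, then `sdec_mono_top`). [this work] -/
theorem sdec_lconv_lconv_blob {x g : ℝ} {N B K : ℕ} {α β : ℕ → ℝ} (hx0 : 0 < x) (hx1 : x < 1) (hxg : x ≤ g) (hg1 : g ≤ 1)
    (hK1 : 1 ≤ K) (hK2 : K ≤ 2) (hpad : 2 * x ≤ g * (K : ℝ))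
    (a0 : ∀ h, 0 ≤ lconv N B α β h) (aM : ∀ h, N + B < h → lconv N B α β h = 0)
    (a1 : ∑ h ∈ Finset.range (N + B + 1), lconv N B α β h = 1)
    (ata : x * ((N + B : ℕ) : ℝ) ≤ ∑ h ∈ Finset.range (N + B + 1), (h : ℝ) * lconv N B α β h)
    (hS : SDEC x (N + B) (lconv N B α β)) :
    SDEC x (N + (B + 2)) (lconv N (B + 2) α (lconv B 2 β (gate δ[K] g))) := by
  have hg0 : 0 ≤ g := hx0.le.trans hxg
  obtain ⟨d0, dM, d1⟩ := gate_laws K δ[K] g hg0 hg1 (fun h => by positivity) (fun h hh => if_neg (by omega)) (by simp)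
  have dmn : ∑ h ∈ Finset.range (K + 1), (h : ℝ) * gate δ[K] g h = g * K := by
    rw [sum_mul_gate]; simp
  have e1 : lconv N (B + 2) α (lconv B 2 β (gate δ[K] g)) = lconv (N + B) K (lconv N B α β) (gate δ[K] g) := by
    rw [lconv_assoc]
    exact funext fun h => lconv_top_right_of_le _ K 2 _ _ hK2 dM h
  rw [e1]
  have h1 : SDEC x (N + B + K) (lconv (N + B) K (lconv N B α β) (gate δ[K] g)) := by
    rw [lconv_gate_point_eq_slice _ K _ g aM]
    exact sdec_slice_blob_of_mixLaw' gatedSliceMixLaw'_holds x g (N + B) K _ hx0 hx1 hxg hg1 hK1 a0 aM a1 ata hS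
  refine sdec_mono_top hx0 hx1 (lconv_nonneg _ _ _ _ a0 d0) (fun h hh => lconv_eq_zero _ _ _ _ h hh)
    (sum_lconv _ _ _ _ a1 d1) (by omega) ?_ h1
  rw [sum_mul_lconv _ _ _ _ a1 d1, dmn]
  push_cast at ata ⊢
  linarith

/-- **the near-sure branch (bookkeeping)**: `α ∗ (β ∗ C) = (α ∗ C) ∗ β` with the tops `N`, `B`, `2`. [this work] -/
theorem lconv_lconv_right_comm (N B : ℕ) (α β C : ℕ → ℝ) :
    lconv N (B + 2) α (lconv B 2 β C) = lconv (N + 2) B (lconv N 2 α C) β := by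
  rw [lconv_comm B 2 β C, Nat.add_comm B 2, lconv_assoc]

/-- **assembling the induction step**: for a probability law `t` on `{0,1,2}` of mean `0 < m < 2`, `α ∗ (β ∗ t)` is SDEC at `x` as soon as
the double-blob branch is, and the relay branch (if `m ≤ 1`) or the near-sure branch (if `m ≥ 1`) is — the chords
`topTwo_mix_lo/hi_mul` and `sdec_lconv_of_mixture`. [this work] -/
theorem sdec_topTwo_assemble {x : ℝ} {N B : ℕ} {α β t : ℕ → ℝ} (m : ℝ)
    (a1 : ∑ h ∈ Finset.range (N + 1), α h = 1) (f1 : ∑ h ∈ Finset.range (B + 1), β h = 1)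
    (t0 : ∀ h, 0 ≤ t h) (tM : ∀ h, 2 < h → t h = 0) (t1 : t 0 + t 1 + t 2 = 1) (hm : t 1 + 2 * t 2 = m)
    (hm0 : 0 < m) (hm2 : m < 2)
    (hD : SDEC x (N + (B + 2)) (lconv N (B + 2) α (lconv B 2 β (gate δ[2] (m / 2)))))
    (hB : m ≤ 1 → SDEC x (N + (B + 2)) (lconv N (B + 2) α (lconv B 2 β (gate δ[1] m))))
    (hC : 1 ≤ m → SDEC x (N + (B + 2)) (lconv N (B + 2) α (lconv B 2 β (ρ₂[m - 1])))) :
    SDEC x (N + (B + 2)) (lconv N (B + 2) α (lconv B 2 β t)) := by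
  obtain ⟨_, _, d1⟩ := gate_laws 2 δ[2] (m / 2) (by linarith) (by linarith) (fun h => by positivity)
    (fun h hh => if_neg (by omega)) (by simp)
  have dmn : ∑ h ∈ Finset.range (2 + 1), (h : ℝ) * gate δ[2] (m / 2) h = m := by
    simp [Finset.sum_range_succ, gate_apply]; ring
  rcases le_or_gt m 1 with hm1 | hm1
  · -- m ≤ 1: t = (2t₂/m)·D + (t₁/m)·B
    have b12 : ∑ h ∈ Finset.range (2 + 1), gate δ[1] m h = 1 := by simp [Finset.sum_range_succ, gate_apply]
    have bmn : ∑ h ∈ Finset.range (2 + 1), (h : ℝ) * gate δ[1] m h = m := by simp [Finset.sum_range_succ, gate_apply]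
    have hw0 : 0 ≤ 2 * t 2 / m := div_nonneg (by linarith [t0 2]) hm0.le
    have hw1 : 2 * t 2 / m ≤ 1 := by rw [div_le_one hm0]; linarith [t0 1]
    have hmix : ∀ h, t h = 2 * t 2 / m * gate δ[2] (m / 2) h + (1 - 2 * t 2 / m) * gate δ[1] m h := by
      intro h
      have k := topTwo_mix_lo_mul t m tM t1 hm h
      have e : 1 - 2 * t 2 / m = t 1 / m := by
        rw [eq_div_iff hm0.ne', sub_mul, div_mul_cancel₀ _ hm0.ne']; linarith
      rw [e, div_mul_eq_mul_div, div_mul_eq_mul_div, ← add_div, eq_div_iff hm0.ne']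
      linear_combination k
    exact sdec_lconv_of_mixture x _ _ α _ _ _ (2 * t 2 / m) hw0 hw1 (lconv_mix_right _ _ _ _ _ _ _ hmix) a1
      (sum_lconv _ _ _ _ f1 d1) (sum_lconv _ _ _ _ f1 b12)
      (by rw [sum_mul_lconv _ _ _ _ f1 d1, sum_mul_lconv _ _ _ _ f1 b12, dmn, bmn]) hD (hB hm1)
  · -- 1 < m < 2: t = (2t₀/(2−m))·D + (t₁/(2−m))·C
    obtain ⟨_, _, l1, lmn, _⟩ := lawC_facts (m - 1) (by linarith) (by linarith)
    have hm20 : 0 < 2 - m := by linarith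
    have hw0 : 0 ≤ 2 * t 0 / (2 - m) := div_nonneg (by linarith [t0 0]) hm20.le
    have hw1 : 2 * t 0 / (2 - m) ≤ 1 := by rw [div_le_one hm20]; linarith [t0 1]
    have hmix : ∀ h, t h = 2 * t 0 / (2 - m) * gate δ[2] (m / 2) h + (1 - 2 * t 0 / (2 - m)) * (ρ₂[m - 1]) h := by
      intro h
      have k := topTwo_mix_hi_mul t m tM t1 hm h
      have e : 1 - 2 * t 0 / (2 - m) = t 1 / (2 - m) := by
        rw [eq_div_iff hm20.ne', sub_mul, div_mul_cancel₀ _ hm20.ne']; linarith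
      rw [e, div_mul_eq_mul_div, div_mul_eq_mul_div, ← add_div, eq_div_iff hm20.ne']
      linear_combination k
    exact sdec_lconv_of_mixture x _ _ α _ _ _ (2 * t 0 / (2 - m)) hw0 hw1 (lconv_mix_right _ _ _ _ _ _ _ hmix) a1
      (sum_lconv _ _ _ _ f1 d1) (sum_lconv _ _ _ _ f1 l1)
      (by rw [sum_mul_lconv _ _ _ _ f1 d1, sum_mul_lconv _ _ _ _ f1 l1, dmn, lmn]; ring) hD (hC hm1.le)

end LawDec
end Quant
end Summit.CriticalPhenomena.PercolationContinuityZ3.Theorems
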